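import Summits.QuantumFields.BalabanUV.T4Continuum.Support.NE3CovariantTentInterpolantMean
import HarnessLib

/-!
# T⁴ programme, node NE3 — row E-MLw-(w4)-P-curved, route H♮, row K5c♯ (file F♯1): THE EXACT DIRICHLET ENERGY OF THE TENT BUMP
# and the sharp covariant energy of a dressed bump

NE3 (node U1b) formalisation swarm, leaf seat `b2b-balaban-t4-ne3-formalise-leaf-01` (gen 7); row **K5** of ruling ρ-g22-2, sub-row
**K5c♯** = LEVER (4) of the (P♮)_W census (disprover note D-ne3r2-g10-2 (4), `HOME/CLAIMS.log` l.20809: «f4∕f5∕6b's TENT CONSTANTS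
`64^d·2^{3d+2}` (A₁ = 2.6e13) … the largest remaining lever by far»; INTENT l.20912).  WHERE THE ORDERS SIT.  K5a `NE3TentBump` bounds
the bump's coboundary POINTWISE by `1∕M` (`norm_dPot_bump_le`), so `sum_normSq_dPot_bump_le` reads `d·(M^d∕M²)·Σ‖c‖²` and f3's dressed
twin `sum_normSq_gaugeDir_dressW_bump_le` reads `d·M^d·κ²·Σ‖c‖²`, `κ = 1∕M + 2(d−1)(M−1)a`; against the exact block mean
`tentSum = ((M²−1)∕(6M))^d` (f5's `norm_compCoef_le`: `tentSum ≥ (M∕8)^d`) this costs `64^d`.  THIS FILE computes the bump's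
Dirichlet energy EXACTLY and keeps the tent profile in the dressed twin.

CONTENT ([folklore]; 0 sorry; 0 def; `fac(t) = (t∕M)(1 − t∕M)`, `fac(0) = fac(M) = 0`; `T = (M²−1)∕(6M) = tentSum^{1∕d}`):
§1 power sums and the profile sums **`sum_fac_sq`** `S₀ := Σ_{t<M} fac(t)² = (M⁴−1)∕(30M³)`, **`sum_dfac_sq`** `S₁ := Σ_{t<M} (fac(t+1) − fac(t))²
   = (M²−1)∕(3M³)`; `S₀ ≤ (2∕M)T²`, `S₁ ≤ (16∕M³)T²` (`M ≥ 2`);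
§2 `tent_sub_eq` (`tent(y+e_α) − tent(y) = Δfac_α·Π_{i≠α} fac_i`), **`sum_block_tent_sq`** `= S₀^d`, **`sum_block_dtent_sq`** `= S₁·S₀^{d−1}`;
§3 **`dPot_bump_eq`** `dPot (bump M c) y α = (tent(y+e_α) − tent(y))•c(blk y)` (crossing bonds included: the arriving tent is `0`) and the EXACT
   energy **`sum_normSq_dPot_bump_eq`**: `Σ_{y∈periodBox(M·N)}Σ_α ‖dPot (bump M c) y α‖² = d·S₁·S₀^{d−1}·Σ_z ‖c z‖²` (`≈ (10d∕30^d)·M^{d−2}`, tree: `d·M^{d−2}`);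
§4 dressed twin (`W` unitary, `SmallField W a`): `norm_gaugeDir_dressW_bump_le_sharp` (f3's in-block∕far-face split, profile kept) and
   **`sum_normSq_gaugeDir_dressW_bump_le_sharp`**: `≤ 2·(d·S₁·S₀^{d−1} + d·(2(d−1)(M−1)a)²·S₀^d)·Σ_z ‖c z‖²`;
§5 (`M ≥ 2`) **`sum_normSq_gaugeDir_dressW_bump_le_tentSum`**: `≤ d·2^{d+1}·(M^d)⁻¹·(8∕M² + (2(d−1)(M−1)a)²)·tentSum²·Σ_z ‖c z‖²` — the
   competitor's coefficient `tentSum⁻¹•(…)` cancels `tentSum²`; against the tree's `d·M^d·κ²·64^d·(M^d)^{−2}·tentSum²`: `64^d ↦ 2^{d+4}`.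

HONEST FRAMING.  Elementary lattice calculus of OUR bump; nothing about Bałaban's minimisers; (P♮)_W ∕ (ML_w) at W ≠ 1, T-E_w and
**NE3 are NOT proved**; spine PROVED 0∕9; finite T⁴ rung (B)+1 — NOT infinite volume, NOT mass gap, NOT `BetaPertH`, NOT Clay.
PLACEMENT: `Summits/QuantumFields/BalabanUV/`.  HONEST DEPENDENCY (cell page 1): continuum YM on T⁴ ⇐ BetaPertH ∧ nine spine estimates
(0/9 proved); BetaPertH ⇐ (D1) ∧ (D4) ∧ CAP+tail; G-an2-4 gates asym, D1 and NE2/3/4.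
-/

set_option autoImplicit false

open scoped BigOperators Matrix.Norms.L2Operator
open Finset

namespace Summit.QuantumFields.BalabanUV.T4Continuum.NE3TentBumpSharp

open Literature.MathematicalPhysics.QuantumFieldTheory.Balaban1983to89
open B7Prop1Explicit B7Prop2Explicit
open T4AveragingDeficitWall (IsUnitaryCfg SmallField Ad)
open T4AveragingDeficitWallBoundary (periodBox mem_periodBox card_periodBox)
open AveragingDeficitTransport (norm_Ad_of_unitary)
open AveragingDeficitBlockDensity (btree btree_mem)
open BlockAveragePushDirGauge (gaugeDir)
open SmoothRefineBlocks (blk res blk_add_e res_add_e_self res_add_e_ne res_boxVec res_le res_nonneg blk_res_eq_of)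
open SmoothRefineInterp (wt wt_nonneg wt_le_one)
open NE3BlockLineAverage (sum_univ_boxVec sum_periodBox_blocks)
open NE3TangentNoGoWords (dPot)
open NE3CoarseInterpolant (blk_block)
open NE3TentBump (fac fac_nonneg fac_eq_zero_of_res_eq_zero wt_eq tent tent_nonneg tent_le_one tent_eq_zero_of_res_eq_zero tentSum tentSum_eq
  bump bump_of_res_eq_zero)
open NE3DressedBlockField (dressW cdiv_block norm_gaugeDir_dressW_inblock_le)

noncomputable section

variable {d : ℕ}

/-! ## §1 Power sums and the two profile sums -/
/-- `Σ_{t<M} t² = M(M−1)(2M−1)∕6`, `Σ_{t<M} t³ = (M(M−1)∕2)²`, `Σ_{t<M} t⁴ = M(M−1)(2M−1)(3M²−3M−1)∕30`. [folklore] -/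
theorem sum_range_pow_two_three_four (M : ℕ) :
    (∑ t ∈ Finset.range M, (t : ℝ) ^ 2) = (M : ℝ) * ((M : ℝ) - 1) * (2 * M - 1) / 6 ∧
      (∑ t ∈ Finset.range M, (t : ℝ) ^ 3) = ((M : ℝ) * ((M : ℝ) - 1) / 2) ^ 2 ∧
        (∑ t ∈ Finset.range M, (t : ℝ) ^ 4) = (M : ℝ) * ((M : ℝ) - 1) * (2 * M - 1) * (3 * (M : ℝ) ^ 2 - 3 * M - 1) / 30 := by
  induction M with
  | zero => simp
  | succ M ih =>
    obtain ⟨h2, h3, h4⟩ := ih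
    refine ⟨?_, ?_, ?_⟩
    · rw [Finset.sum_range_succ, h2]; push_cast; ring
    · rw [Finset.sum_range_succ, h3]; push_cast; ring
    · rw [Finset.sum_range_succ, h4]; push_cast; ring
/-- **`S₀(M) = Σ_{t<M} ((t∕M)(1 − t∕M))² = (M⁴ − 1)∕(30M³)`** (`M ≥ 1`). [folklore] -/
theorem sum_fac_sq {M : ℕ} (hM : 1 ≤ M) :
    ∑ t : Fin M, (((t : ℕ) : ℝ) / M * (1 - ((t : ℕ) : ℝ) / M)) ^ 2 = (((M : ℝ)) ^ 4 - 1) / (30 * (M : ℝ) ^ 3) := by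
  have hM0 : (M : ℝ) ≠ 0 := by exact_mod_cast (by omega : M ≠ 0)
  obtain ⟨h2, h3, h4⟩ := sum_range_pow_two_three_four M
  rw [Fin.sum_univ_eq_sum_range (fun t => ((t : ℝ) / M * (1 - (t : ℝ) / M)) ^ 2) M]
  have hterm : ∀ t ∈ Finset.range M, ((t : ℝ) / M * (1 - (t : ℝ) / M)) ^ 2
      = (1 / (M : ℝ) ^ 4) * ((M : ℝ) ^ 2 * (t : ℝ) ^ 2 - 2 * (M : ℝ) * (t : ℝ) ^ 3 + (t : ℝ) ^ 4) := by
    intro t _; field_simp; ring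
  rw [Finset.sum_congr rfl hterm, ← Finset.mul_sum, Finset.sum_add_distrib, Finset.sum_sub_distrib, ← Finset.mul_sum,
    ← Finset.mul_sum, h2, h3, h4]
  field_simp
  ring
/-- **`S₁(M) = Σ_{t<M} (fac(t+1) − fac(t))² = (M² − 1)∕(3M³)`** (`M ≥ 1`; `fac(M) = 0` is automatic in the formula). [folklore] -/
theorem sum_dfac_sq {M : ℕ} (hM : 1 ≤ M) :
    ∑ t : Fin M, ((((t : ℕ) : ℝ) + 1) / M * (1 - (((t : ℕ) : ℝ) + 1) / M) - ((t : ℕ) : ℝ) / M * (1 - ((t : ℕ) : ℝ) / M)) ^ 2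
      = (((M : ℝ)) ^ 2 - 1) / (3 * (M : ℝ) ^ 3) := by
  have hM0 : (M : ℝ) ≠ 0 := by exact_mod_cast (by omega : M ≠ 0)
  obtain ⟨h2, -, -⟩ := sum_range_pow_two_three_four M
  have h1 := (NE3TentBump.sum_range_mul_sub M).1
  rw [Fin.sum_univ_eq_sum_range
    (fun t => (((t : ℝ) + 1) / M * (1 - ((t : ℝ) + 1) / M) - (t : ℝ) / M * (1 - (t : ℝ) / M)) ^ 2) M]
  have hterm : ∀ t ∈ Finset.range M, (((t : ℝ) + 1) / M * (1 - ((t : ℝ) + 1) / M) - (t : ℝ) / M * (1 - (t : ℝ) / M)) ^ 2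
      = (1 / (M : ℝ) ^ 4) * (((M : ℝ) - 1) ^ 2 - 4 * ((M : ℝ) - 1) * (t : ℝ) + 4 * (t : ℝ) ^ 2) := by
    intro t _; field_simp; ring
  rw [Finset.sum_congr rfl hterm, ← Finset.mul_sum, Finset.sum_add_distrib, Finset.sum_sub_distrib, Finset.sum_const,
    Finset.card_range, nsmul_eq_mul, ← Finset.mul_sum, ← Finset.mul_sum, h1, h2]
  field_simp
  ring
/-- `S₀ ≤ (2∕M)·T²` with `T = (M²−1)∕(6M)` (`M ≥ 2`). [folklore] -/
theorem S0_le {M : ℕ} (hM : 2 ≤ M) :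
    (((M : ℝ)) ^ 4 - 1) / (30 * (M : ℝ) ^ 3) ≤ (2 / (M : ℝ)) * ((((M : ℝ)) ^ 2 - 1) / (6 * M)) ^ 2 := by
  have hM2 : (2 : ℝ) ≤ M := by exact_mod_cast hM
  have hM0 : (0 : ℝ) < M := by linarith
  rw [div_pow, div_le_iff₀ (by positivity), show (2 : ℝ) / M * ((((M : ℝ)) ^ 2 - 1) ^ 2 / (6 * (M : ℝ)) ^ 2) * (30 * (M : ℝ) ^ 3)
    = (5 / 3) * ((((M : ℝ)) ^ 2 - 1) ^ 2) by field_simp; ring]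
  have h1 : (0 : ℝ) ≤ (M : ℝ) ^ 2 - 1 := by nlinarith
  have h2 : (0 : ℝ) ≤ (M : ℝ) ^ 2 - 4 := by nlinarith
  nlinarith [mul_nonneg h1 h2]
/-- `S₁ ≤ (16∕M³)·T²` with `T = (M²−1)∕(6M)` (`M ≥ 2`). [folklore] -/
theorem S1_le {M : ℕ} (hM : 2 ≤ M) :
    (((M : ℝ)) ^ 2 - 1) / (3 * (M : ℝ) ^ 3) ≤ (16 / (M : ℝ) ^ 3) * ((((M : ℝ)) ^ 2 - 1) / (6 * M)) ^ 2 := by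
  have hM2 : (2 : ℝ) ≤ M := by exact_mod_cast hM
  have hM0 : (0 : ℝ) < M := by linarith
  rw [div_pow, div_le_iff₀ (by positivity), show (16 : ℝ) / (M : ℝ) ^ 3 * ((((M : ℝ)) ^ 2 - 1) ^ 2 / (6 * (M : ℝ)) ^ 2) * (3 * (M : ℝ) ^ 3)
    = (4 / 3) * ((((M : ℝ)) ^ 2 - 1) ^ 2) / (M : ℝ) ^ 2 by field_simp; ring]
  rw [le_div_iff₀ (by positivity)]
  have h1 : (0 : ℝ) ≤ (M : ℝ) ^ 2 - 1 := by nlinarith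
  have h2 : (0 : ℝ) ≤ (M : ℝ) ^ 2 - 4 := by nlinarith
  nlinarith [mul_nonneg h1 h2]

/-! ## §2 Block sums of the squared tent and of its squared increments -/
/-- The factor of direction `α` after a unit step in direction `α` — crossing included (there it is `fac(M) = 0`):
`fac M (y + e α) α = ((ρ_α+1)∕M)(1 − (ρ_α+1)∕M)`. [folklore] -/
theorem fac_add_e_self' {M : ℕ} (hM : 1 ≤ M) (y : Site d) (α : Fin d) :
    fac M (y + e α) α = (((res M y α : ℝ)) + 1) / M * (1 - (((res M y α : ℝ)) + 1) / M) := by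
  have hM0 : (M : ℝ) ≠ 0 := by exact_mod_cast (by omega : M ≠ 0)
  unfold fac
  rw [wt_eq, res_add_e_self hM]
  split_ifs with h
  · rw [h]; push_cast; field_simp; ring
  · push_cast; ring
/-- The factors of the other directions are unchanged by a unit step in direction `α`. [folklore] -/
theorem fac_add_e_ne {M : ℕ} (hM : 1 ≤ M) (y : Site d) {α i : Fin d} (h : i ≠ α) : fac M (y + e α) i = fac M y i := by
  unfold fac; rw [wt_eq, wt_eq, res_add_e_ne hM y h]
/-- **THE TENT INCREMENT FACTORISES**: `tent M (y + e α) − tent M y = (fac M (y+e α) α − fac M y α)·Π_{i≠α} fac M y i`. [folklore] -/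
theorem tent_sub_eq {M : ℕ} (hM : 1 ≤ M) (y : Site d) (α : Fin d) :
    tent M (y + e α) - tent M y = (fac M (y + e α) α - fac M y α) * ∏ i ∈ Finset.univ.erase α, fac M y i := by
  unfold tent
  rw [← Finset.mul_prod_erase _ _ (Finset.mem_univ α), ← Finset.mul_prod_erase Finset.univ (fac M y) (Finset.mem_univ α),
    Finset.prod_congr rfl fun i hi => fac_add_e_ne hM y (Finset.ne_of_mem_erase hi), ← sub_mul]
/-- **`Σ_{v∈[0,M)^d} tent(M•z + v)² = S₀(M)^d`** (`M ≥ 1`). [folklore] -/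
theorem sum_block_tent_sq {M : ℕ} (hM : 1 ≤ M) (z : Site d) :
    ∑ v ∈ periodBox (d := d) M, tent M ((M : ℤ) • z + v) ^ 2 = ((((M : ℝ)) ^ 4 - 1) / (30 * (M : ℝ) ^ 3)) ^ d := by
  rw [← sum_univ_boxVec M (fun v => tent M ((M : ℤ) • z + v) ^ 2)]
  have hterm : ∀ r : Fin d → Fin M, tent M ((M : ℤ) • z + boxVec M r) ^ 2
      = ∏ i : Fin d, (((r i : ℕ) : ℝ) / M * (1 - ((r i : ℕ) : ℝ) / M)) ^ 2 := by
    intro r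
    unfold tent fac
    rw [← Finset.prod_pow]
    refine Finset.prod_congr rfl fun i _ => ?_
    rw [wt_eq, res_boxVec hM z r]
    simp [boxVec]
  rw [Finset.sum_congr rfl fun r _ => hterm r, ← Fintype.piFinset_univ,
    ← Finset.prod_univ_sum (fun _ : Fin d => (Finset.univ : Finset (Fin M)))
      (fun _ (t : Fin M) => (((t : ℕ) : ℝ) / M * (1 - ((t : ℕ) : ℝ) / M)) ^ 2),
    Finset.prod_const, Finset.card_univ, Fintype.card_fin, sum_fac_sq hM]
/-- **`Σ_{v∈[0,M)^d} (tent(M•z + v + e_α) − tent(M•z + v))² = S₁(M)·S₀(M)^{d−1}`** (`M ≥ 1`, `d ≥ 1` through `α`). [folklore] -/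
theorem sum_block_dtent_sq {M : ℕ} (hM : 1 ≤ M) (z : Site d) (α : Fin d) :
    ∑ v ∈ periodBox (d := d) M, (tent M ((M : ℤ) • z + v + e α) - tent M ((M : ℤ) • z + v)) ^ 2
      = (((M : ℝ)) ^ 2 - 1) / (3 * (M : ℝ) ^ 3) * (((((M : ℝ)) ^ 4 - 1) / (30 * (M : ℝ) ^ 3)) ^ (d - 1)) := by
  let h : Fin d → Fin M → ℝ := fun i t =>
    if i = α then ((((t : ℕ) : ℝ) + 1) / M * (1 - (((t : ℕ) : ℝ) + 1) / M) - ((t : ℕ) : ℝ) / M * (1 - ((t : ℕ) : ℝ) / M)) ^ 2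
    else (((t : ℕ) : ℝ) / M * (1 - ((t : ℕ) : ℝ) / M)) ^ 2
  rw [← sum_univ_boxVec M (fun v => (tent M ((M : ℤ) • z + v + e α) - tent M ((M : ℤ) • z + v)) ^ 2)]
  have hterm : ∀ r : Fin d → Fin M,
      (tent M ((M : ℤ) • z + boxVec M r + e α) - tent M ((M : ℤ) • z + boxVec M r)) ^ 2 = ∏ i : Fin d, h i (r i) := by
    intro r
    have hres : ∀ i, (res M ((M : ℤ) • z + boxVec M r) i : ℝ) = ((r i : ℕ) : ℝ) := by
      intro i; rw [res_boxVec hM z r]; simp [boxVec]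
    rw [tent_sub_eq hM, mul_pow, ← Finset.prod_pow, ← Finset.mul_prod_erase Finset.univ (fun i => h i (r i)) (Finset.mem_univ α)]
    congr 1
    · simp only [h, if_pos rfl]
      rw [fac_add_e_self' hM]
      unfold fac
      rw [wt_eq, hres α]
    · refine Finset.prod_congr rfl fun i hi => ?_
      have hne : i ≠ α := Finset.ne_of_mem_erase hi
      simp only [h, if_neg hne]
      unfold fac
      rw [wt_eq, hres i]
  rw [Finset.sum_congr rfl fun r _ => hterm r, ← Fintype.piFinset_univ,
    ← Finset.prod_univ_sum (fun _ : Fin d => (Finset.univ : Finset (Fin M))) h,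
    ← Finset.mul_prod_erase _ _ (Finset.mem_univ α)]
  have hα : ∑ t : Fin M, h α t = (((M : ℝ)) ^ 2 - 1) / (3 * (M : ℝ) ^ 3) := by
    simp only [h, if_pos rfl]; exact sum_dfac_sq hM
  have hi : ∀ i ∈ Finset.univ.erase α, ∑ t : Fin M, h i t = (((M : ℝ)) ^ 4 - 1) / (30 * (M : ℝ) ^ 3) := by
    intro i hi
    have hne : i ≠ α := Finset.ne_of_mem_erase hi
    simp only [h, if_neg hne]; exact sum_fac_sq hM
  rw [hα, Finset.prod_congr rfl hi, Finset.prod_const, Finset.card_erase_of_mem (Finset.mem_univ α), Finset.card_univ,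
    Fintype.card_fin]

/-! ## §3 The exact Dirichlet energy of the bump -/

section Bump

variable {𝔸 : Type*} [NormedRing 𝔸] [NormedSpace ℝ 𝔸]
/-- **THE COBOUNDARY OF THE BUMP IS THE TENT INCREMENT TIMES THE LOCAL DATUM** — on every bond, crossing bonds included (there the
arriving tent vanishes): `dPot (bump M c) y α = (tent M (y + e α) − tent M y) • c (blk M y)` (`M ≥ 1`). [folklore] -/
theorem dPot_bump_eq {M : ℕ} (hM : 1 ≤ M) (c : Site d → 𝔸) (y : Site d) (α : Fin d) :
    dPot (bump M c) y α = (tent M (y + e α) - tent M y) • c (blk M y) := by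
  simp only [dPot, bump]
  by_cases h : res M y α = (M : ℤ) - 1
  · have hres' : res M (y + e α) α = 0 := by rw [res_add_e_self hM, if_pos h]
    rw [tent_eq_zero_of_res_eq_zero hres', zero_smul, zero_sub, zero_sub, neg_smul]
  · have hblk : blk M (y + e α) = blk M y := by rw [blk_add_e hM, if_neg h, add_zero]
    rw [hblk, ← sub_smul]
/-- The energy of the bump over one block: `Σ_{v∈[0,M)^d} Σ_α ‖dPot (bump M c) (M•z+v) α‖² = d·S₁·S₀^{d−1}·‖c z‖²`. [folklore] -/
theorem sum_block_normSq_dPot_bump {M : ℕ} (hM : 1 ≤ M) (c : Site d → 𝔸) (z : Site d) :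
    ∑ v ∈ periodBox (d := d) M, ∑ α : Fin d, ‖dPot (bump M c) ((M : ℤ) • z + v) α‖ ^ 2
      = (d : ℝ) * ((((M : ℝ)) ^ 2 - 1) / (3 * (M : ℝ) ^ 3) * (((((M : ℝ)) ^ 4 - 1) / (30 * (M : ℝ) ^ 3)) ^ (d - 1)))
          * ‖c z‖ ^ 2 := by
  have hterm : ∀ v ∈ periodBox (d := d) M, ∀ α : Fin d, ‖dPot (bump M c) ((M : ℤ) • z + v) α‖ ^ 2
      = (tent M ((M : ℤ) • z + v + e α) - tent M ((M : ℤ) • z + v)) ^ 2 * ‖c z‖ ^ 2 := by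
    intro v hv α
    rw [dPot_bump_eq hM, blk_block hM z hv, norm_smul, Real.norm_eq_abs, mul_pow, sq_abs]
  rw [Finset.sum_congr rfl fun v hv => Finset.sum_congr rfl fun α _ => hterm v hv α, Finset.sum_comm]
  simp only [← Finset.sum_mul]
  rw [Finset.sum_congr rfl fun α _ => by rw [sum_block_dtent_sq hM z α], Finset.sum_const, Finset.card_univ, Fintype.card_fin,
    nsmul_eq_mul]
/-- **THE EXACT DIRICHLET ENERGY OF THE TENT BUMP** over the torus of side `M·N` (`M ≥ 1`, any `N`):
`Σ_{y∈periodBox (M·N)} Σ_α ‖dPot (bump M c) y α‖² = d·S₁(M)·S₀(M)^{d−1}·Σ_{z∈periodBox N} ‖c z‖²`,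
`S₁ = (M²−1)∕(3M³)`, `S₀ = (M⁴−1)∕(30M³)` — against the tree's `d·(M^d∕M²)` this is smaller by `≈ 30^d∕10`. [folklore] -/
theorem sum_normSq_dPot_bump_eq {M : ℕ} (hM : 1 ≤ M) (N : ℕ) (c : Site d → 𝔸) :
    ∑ y ∈ periodBox (d := d) (M * N), ∑ α : Fin d, ‖dPot (bump M c) y α‖ ^ 2
      = (d : ℝ) * ((((M : ℝ)) ^ 2 - 1) / (3 * (M : ℝ) ^ 3) * (((((M : ℝ)) ^ 4 - 1) / (30 * (M : ℝ) ^ 3)) ^ (d - 1)))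
          * ∑ z ∈ periodBox (d := d) N, ‖c z‖ ^ 2 := by
  rw [← sum_periodBox_blocks M N hM, Finset.mul_sum]
  exact Finset.sum_congr rfl fun z _ => sum_block_normSq_dPot_bump hM c z

end Bump

/-! ## §4 The dressed covariant twin -/

section Dressed

variable {n : Type*} [Fintype n] [DecidableEq n] [Nonempty n]
/-- **A DRESSED BUMP, BOND BY BOND, WITH THE PROFILE KEPT** (`M ≥ 1`, `W` unitary, `SmallField W a`, `0 ≤ a`): for every bond
`(M•z + v, α)`, `v ∈ [0,M)^d`,
`‖gaugeDir W (dressW M W (bump M c)) (M•z+v) α‖ ≤ (|tent(y+e_α) − tent(y)| + 2(d−1)(M−1)a·tent(y))·‖c z‖` (`y = M•z+v`) —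
f3's `norm_gaugeDir_dressW_bump_le` with `|Δtent|` in place of `1∕M`. [folklore] -/
theorem norm_gaugeDir_dressW_bump_le_sharp {M : ℕ} (hM : 1 ≤ M) {W : Site d → Fin d → (Matrix n n ℂ)ˣ} (hW : IsUnitaryCfg W)
    {a : ℝ} (ha : 0 ≤ a) (hWa : SmallField W a) (c : Site d → Matrix n n ℂ) (z : Site d) {v : Site d}
    (hv : v ∈ periodBox (d := d) M) (α : Fin d) :
    ‖gaugeDir W (dressW M W (bump M c)) ((M : ℤ) • z + v) α‖
      ≤ (|tent M ((M : ℤ) • z + v + e α) - tent M ((M : ℤ) • z + v)|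
          + 2 * (((d : ℝ) - 1) * ((M : ℝ) - 1) * a) * tent M ((M : ℤ) • z + v)) * ‖c z‖ := by
  have hM0 : (0 : ℝ) < M := by exact_mod_cast (by omega : 0 < M)
  have hd1 : (1 : ℝ) ≤ d := by exact_mod_cast Fin.pos α
  have hM1 : (1 : ℝ) ≤ M := by exact_mod_cast hM
  have hK0 : 0 ≤ ((d : ℝ) - 1) * ((M : ℝ) - 1) * a := mul_nonneg (mul_nonneg (by linarith) (by linarith)) ha
  set y : Site d := (M : ℤ) • z + v with hy
  have hvi := fun i => (mem_periodBox.1 hv i)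
  obtain ⟨hblk, hres⟩ := blk_res_eq_of (L := M) hM hy.symm (fun i => (hvi i).1) (fun i => (hvi i).2)
  have hcd : SkeletonLattice.cdiv M y = z := by rw [hy]; exact cdiv_block z hv
  have ht0 := tent_nonneg hM y
  have hbumpy : ‖bump M c y‖ = tent M y * ‖c z‖ := by
    unfold bump; rw [norm_smul, Real.norm_of_nonneg ht0, hblk]
  by_cases hface : v α = (M : ℤ) - 1
  · -- the far face: the bump at `y + e α` vanishes, so the bond carries `tent(y)·‖c z‖ = |Δtent|·‖c z‖`
    have hry : res M y α = (M : ℤ) - 1 := by rw [hres]; exact hface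
    have hr0 : res M (y + e α) α = 0 := by rw [res_add_e_self hM, if_pos hry]
    have hzero : bump M c (y + e α) = 0 := bump_of_res_eq_zero M c hr0
    have ht' : tent M (y + e α) = 0 := tent_eq_zero_of_res_eq_zero hr0
    have hgd : gaugeDir W (dressW M W (bump M c)) y α = Ad (W y α)⁻¹ (dressW M W (bump M c) y) := by
      simp only [gaugeDir, dressW, hzero, AveragingDeficitNearIdentity.Ad_zero, sub_zero]
    rw [hgd, norm_Ad_of_unitary ((unitaryUnits _).inv_mem (hW y α)), dressW,
      norm_Ad_of_unitary ((unitaryUnits _).inv_mem (btree_mem hW M _ _)), hbumpy, ht', zero_sub, abs_neg, abs_of_nonneg ht0]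
    have hx : 0 ≤ 2 * (((d : ℝ) - 1) * ((M : ℝ) - 1) * a) * tent M y * ‖c z‖ := by positivity
    nlinarith [hx]
  · -- inside the block: both ends in block `z`
    have hvα : v α + 1 < M := by
      have := (hvi α).2; omega
    have hv' : v + e α ∈ periodBox (d := d) M := by
      rw [mem_periodBox]; intro i
      by_cases hi : i = α
      · subst hi; simp only [Pi.add_apply, B8Lemma1NonAbelian.e_apply_self]; exact ⟨by linarith [(hvi i).1], hvα⟩
      · simp only [Pi.add_apply, B8Lemma1NonAbelian.e_apply_of_ne hi, add_zero]; exact hvi i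
    have hcd' : SkeletonLattice.cdiv M (y + e α) = SkeletonLattice.cdiv M y := by
      rw [hcd, hy, add_assoc]; exact cdiv_block z hv'
    refine (norm_gaugeDir_dressW_inblock_le hM hW ha hWa (bump M c) hcd').trans ?_
    rw [dPot_bump_eq hM c y α, hblk, norm_smul, Real.norm_eq_abs, hbumpy, add_mul]
    refine add_le_add le_rfl (le_of_eq ?_)
    ring
/-- **THE SHARP COVARIANT ENERGY OF A DRESSED BUMP** (`M ≥ 1`, any `N`, `W` unitary, `SmallField W a`):
`Σ_{y∈periodBox(M·N)} Σ_α ‖gaugeDir W (dressW M W (bump M c)) y α‖² ≤ 2·(d·S₁·S₀^{d−1} + d·(2(d−1)(M−1)a)²·S₀^d)·Σ_{z∈periodBox N} ‖c z‖²`. [folklore] -/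
theorem sum_normSq_gaugeDir_dressW_bump_le_sharp {M : ℕ} (hM : 1 ≤ M) (N : ℕ) {W : Site d → Fin d → (Matrix n n ℂ)ˣ}
    (hW : IsUnitaryCfg W) {a : ℝ} (ha : 0 ≤ a) (hWa : SmallField W a) (c : Site d → Matrix n n ℂ) :
    ∑ y ∈ periodBox (d := d) (M * N), ∑ α : Fin d, ‖gaugeDir W (dressW M W (bump M c)) y α‖ ^ 2
      ≤ 2 * ((d : ℝ) * ((((M : ℝ)) ^ 2 - 1) / (3 * (M : ℝ) ^ 3) * (((((M : ℝ)) ^ 4 - 1) / (30 * (M : ℝ) ^ 3)) ^ (d - 1)))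
              + (d : ℝ) * (2 * (((d : ℝ) - 1) * ((M : ℝ) - 1) * a)) ^ 2 * ((((M : ℝ)) ^ 4 - 1) / (30 * (M : ℝ) ^ 3)) ^ d)
          * ∑ z ∈ periodBox (d := d) N, ‖c z‖ ^ 2 := by
  set κa : ℝ := 2 * (((d : ℝ) - 1) * ((M : ℝ) - 1) * a) with hκa
  rw [← sum_periodBox_blocks M N hM, Finset.mul_sum]
  refine Finset.sum_le_sum fun z _ => ?_
  -- pointwise: `(A + B)² ≤ 2A² + 2B²`
  have hpt : ∀ v ∈ periodBox (d := d) M, ∀ α : Fin d, ‖gaugeDir W (dressW M W (bump M c)) ((M : ℤ) • z + v) α‖ ^ 2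
      ≤ 2 * ((tent M ((M : ℤ) • z + v + e α) - tent M ((M : ℤ) • z + v)) ^ 2 * ‖c z‖ ^ 2)
        + 2 * (κa ^ 2 * (tent M ((M : ℤ) • z + v) ^ 2 * ‖c z‖ ^ 2)) := by
    intro v hv α
    have h := norm_gaugeDir_dressW_bump_le_sharp hM hW ha hWa c z hv α
    rw [← hκa] at h
    have hA := abs_nonneg (tent M ((M : ℤ) • z + v + e α) - tent M ((M : ℤ) • z + v))
    have hκ0 : 0 ≤ κa := by
      have hd1 : (1 : ℝ) ≤ d := by exact_mod_cast Fin.pos α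
      have hM1 : (1 : ℝ) ≤ M := by exact_mod_cast hM
      rw [hκa]; exact mul_nonneg (by norm_num) (mul_nonneg (mul_nonneg (by linarith) (by linarith)) ha)
    have hB : 0 ≤ κa * tent M ((M : ℤ) • z + v) := mul_nonneg hκ0 (tent_nonneg hM ((M : ℤ) • z + v))
    calc ‖gaugeDir W (dressW M W (bump M c)) ((M : ℤ) • z + v) α‖ ^ 2
        ≤ ((|tent M ((M : ℤ) • z + v + e α) - tent M ((M : ℤ) • z + v)| + κa * tent M ((M : ℤ) • z + v)) * ‖c z‖) ^ 2 :=
          pow_le_pow_left₀ (norm_nonneg _) h 2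
      _ ≤ _ := by
          rw [mul_pow]
          nlinarith [sq_abs (tent M ((M : ℤ) • z + v + e α) - tent M ((M : ℤ) • z + v)),
            sq_nonneg (|tent M ((M : ℤ) • z + v + e α) - tent M ((M : ℤ) • z + v)| - κa * tent M ((M : ℤ) • z + v)),
            sq_nonneg ‖c z‖, mul_nonneg hA hB]
  have hsumA : ∑ v ∈ periodBox (d := d) M, ∑ α : Fin d, (tent M ((M : ℤ) • z + v + e α) - tent M ((M : ℤ) • z + v)) ^ 2
      = (d : ℝ) * ((((M : ℝ)) ^ 2 - 1) / (3 * (M : ℝ) ^ 3) * (((((M : ℝ)) ^ 4 - 1) / (30 * (M : ℝ) ^ 3)) ^ (d - 1))) := by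
    rw [Finset.sum_comm, Finset.sum_congr rfl fun α _ => sum_block_dtent_sq hM z α, Finset.sum_const, Finset.card_univ,
      Fintype.card_fin, nsmul_eq_mul]
  have hsumB : ∑ v ∈ periodBox (d := d) M, ∑ _α : Fin d, tent M ((M : ℤ) • z + v) ^ 2
      = (d : ℝ) * ((((M : ℝ)) ^ 4 - 1) / (30 * (M : ℝ) ^ 3)) ^ d := by
    rw [Finset.sum_comm, Finset.sum_congr rfl fun α _ => sum_block_tent_sq hM z, Finset.sum_const, Finset.card_univ,
      Fintype.card_fin, nsmul_eq_mul]
  calc ∑ v ∈ periodBox (d := d) M, ∑ α : Fin d, ‖gaugeDir W (dressW M W (bump M c)) ((M : ℤ) • z + v) α‖ ^ 2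
      ≤ ∑ v ∈ periodBox (d := d) M, ∑ α : Fin d, (2 * ((tent M ((M : ℤ) • z + v + e α) - tent M ((M : ℤ) • z + v)) ^ 2 * ‖c z‖ ^ 2)
        + 2 * (κa ^ 2 * (tent M ((M : ℤ) • z + v) ^ 2 * ‖c z‖ ^ 2))) :=
        Finset.sum_le_sum fun v hv => Finset.sum_le_sum fun α _ => hpt v hv α
    _ = 2 * ‖c z‖ ^ 2 * ∑ v ∈ periodBox (d := d) M, ∑ α : Fin d, (tent M ((M : ℤ) • z + v + e α) - tent M ((M : ℤ) • z + v)) ^ 2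
        + 2 * κa ^ 2 * ‖c z‖ ^ 2 * ∑ v ∈ periodBox (d := d) M, ∑ _α : Fin d, tent M ((M : ℤ) • z + v) ^ 2 := by
        simp only [Finset.sum_add_distrib, Finset.mul_sum]
        congr 1 <;> exact Finset.sum_congr rfl fun v _ => Finset.sum_congr rfl fun α _ => by ring
    _ = _ := by rw [hsumA, hsumB]; ring

/-! ## §5 Against the block mean `tentSum` -/
/-- **THE DRESSED-BUMP ENERGY AGAINST `tentSum²`** (`M ≥ 2`): `Σ‖gaugeDir W (dressW M W (bump M c))‖²
≤ d·2^{d+1}·(M^d)⁻¹·(8∕M² + (2(d−1)(M−1)a)²)·(tentSum d M)²·Σ_z ‖c z‖²` — with the competitor's coefficient `tentSum⁻¹•(…)` the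
`tentSum²` cancels: the tree's `64^d` becomes `2^{d+4}` on the main term. [folklore] -/
theorem sum_normSq_gaugeDir_dressW_bump_le_tentSum {M : ℕ} (hM : 2 ≤ M) (N : ℕ) {W : Site d → Fin d → (Matrix n n ℂ)ˣ}
    (hW : IsUnitaryCfg W) {a : ℝ} (ha : 0 ≤ a) (hWa : SmallField W a) (c : Site d → Matrix n n ℂ) :
    ∑ y ∈ periodBox (d := d) (M * N), ∑ α : Fin d, ‖gaugeDir W (dressW M W (bump M c)) y α‖ ^ 2
      ≤ (d : ℝ) * (2 : ℝ) ^ (d + 1) * ((M : ℝ) ^ d)⁻¹ * (8 / (M : ℝ) ^ 2 + (2 * (((d : ℝ) - 1) * ((M : ℝ) - 1) * a)) ^ 2)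
          * tentSum d M ^ 2 * ∑ z ∈ periodBox (d := d) N, ‖c z‖ ^ 2 := by
  have hM1 : 1 ≤ M := by omega
  have hM2 : (2 : ℝ) ≤ M := by exact_mod_cast hM
  have hM0 : (0 : ℝ) < M := by linarith
  rcases Nat.eq_zero_or_pos d with hd | hd
  · -- no directions: both sides vanish
    subst hd
    simp
  have h := sum_normSq_gaugeDir_dressW_bump_le_sharp hM1 N hW ha hWa c
  refine h.trans (mul_le_mul_of_nonneg_right ?_ (Finset.sum_nonneg fun z _ => sq_nonneg _))
  set T2 : ℝ := ((((M : ℝ)) ^ 2 - 1) / (6 * M)) ^ 2 with hT2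
  have hT0 : 0 ≤ T2 := sq_nonneg _
  have hS0 := S0_le hM
  have hS1 := S1_le hM
  rw [← hT2] at hS0 hS1
  have hS00 : 0 ≤ (((M : ℝ)) ^ 4 - 1) / (30 * (M : ℝ) ^ 3) := by
    have : (1 : ℝ) ≤ (M : ℝ) ^ 4 := one_le_pow₀ (by linarith)
    exact div_nonneg (by linarith) (by positivity)
  have htS : tentSum d M ^ 2 = T2 ^ d := by rw [tentSum_eq hM1, hT2, pow_right_comm]
  set κa : ℝ := 2 * (((d : ℝ) - 1) * ((M : ℝ) - 1) * a) with hκa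
  have hpow1 : ((((M : ℝ)) ^ 4 - 1) / (30 * (M : ℝ) ^ 3)) ^ (d - 1) ≤ (2 / (M : ℝ)) ^ (d - 1) * T2 ^ (d - 1) := by
    rw [← mul_pow]; exact pow_le_pow_left₀ hS00 hS0 _
  have hpow0 : ((((M : ℝ)) ^ 4 - 1) / (30 * (M : ℝ) ^ 3)) ^ d ≤ (2 / (M : ℝ)) ^ d * T2 ^ d := by
    rw [← mul_pow]; exact pow_le_pow_left₀ hS00 hS0 _
  have hA : (((M : ℝ)) ^ 2 - 1) / (3 * (M : ℝ) ^ 3) * ((((M : ℝ)) ^ 4 - 1) / (30 * (M : ℝ) ^ 3)) ^ (d - 1)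
      ≤ (16 / (M : ℝ) ^ 3 * T2) * ((2 / (M : ℝ)) ^ (d - 1) * T2 ^ (d - 1)) :=
    mul_le_mul hS1 hpow1 (pow_nonneg hS00 _) (by positivity)
  have hd1 : d = (d - 1) + 1 := (Nat.sub_add_cancel hd).symm
  have hTd : T2 * T2 ^ (d - 1) = T2 ^ d := by rw [← pow_succ', ← hd1]
  have h2d : (2 / (M : ℝ)) ^ (d - 1) = (2 : ℝ) ^ d * ((M : ℝ) ^ d)⁻¹ * ((M : ℝ) / 2) := by
    have h2 : (2 / (M : ℝ)) ^ d = (2 / (M : ℝ)) ^ (d - 1) * (2 / M) := by rw [← pow_succ, ← hd1]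
    have hne : (2 / (M : ℝ)) ≠ 0 := by positivity
    field_simp
    rw [div_pow] at h2
    field_simp at h2
    linarith [h2]
  have h2d' : (2 / (M : ℝ)) ^ d = (2 : ℝ) ^ d * ((M : ℝ) ^ d)⁻¹ := by rw [div_pow]; ring
  calc 2 * ((d : ℝ) * ((((M : ℝ)) ^ 2 - 1) / (3 * (M : ℝ) ^ 3) * ((((M : ℝ)) ^ 4 - 1) / (30 * (M : ℝ) ^ 3)) ^ (d - 1))
          + (d : ℝ) * κa ^ 2 * ((((M : ℝ)) ^ 4 - 1) / (30 * (M : ℝ) ^ 3)) ^ d)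
      ≤ 2 * ((d : ℝ) * ((16 / (M : ℝ) ^ 3 * T2) * ((2 / (M : ℝ)) ^ (d - 1) * T2 ^ (d - 1)))
          + (d : ℝ) * κa ^ 2 * ((2 / (M : ℝ)) ^ d * T2 ^ d)) := by
        gcongr
    _ = (d : ℝ) * (2 : ℝ) ^ (d + 1) * ((M : ℝ) ^ d)⁻¹ * (8 / (M : ℝ) ^ 2 + κa ^ 2) * tentSum d M ^ 2 := by
        rw [htS, h2d, h2d', show (16 / (M : ℝ) ^ 3 * T2) * ((2 : ℝ) ^ d * ((M : ℝ) ^ d)⁻¹ * ((M : ℝ) / 2) * T2 ^ (d - 1))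
          = 8 / (M : ℝ) ^ 2 * ((2 : ℝ) ^ d * ((M : ℝ) ^ d)⁻¹) * (T2 * T2 ^ (d - 1)) by field_simp; ring, hTd]
        ring

end Dressed

end

end Summit.QuantumFields.BalabanUV.T4Continuum.NE3TentBumpSharp
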